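import Mathlib
import HarnessLib
import Summits.HubbardSuperconductivity.HubbardSuperconductivity.Theorems.KLProgrammeKLRegimeVolumeLimitCutoffFrame

/-!
# Child `KLRegimeVolumeLimitV14` (stmt-HubbardSuperconductivity-19921): THE INVERSE DRESSING `e = g_K/g₀` — frame transfer `K → 0` of
# cutoff-free two-volume rates of the VL carrier, on the Hamiltonian (`M = ∞`) side
# (cell gate-hubbard-kl, seat hubbard-kl-k3c5-p2 g5, technique «analytic-continuation-free assembly via FinalTwoLegVolLimit»; `--supports` the VL child)

`…VolumeLimitV14OfFramedCarrierRate` closes the child DIRECTLY from the FRAMED export (the same-cutoff two-volume rate of the engine's own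
last-scale two-leg kernel `klSelfEnergy L M β U μ K klE0 (nScales β + 1)` at the admissible frame `K` of the binders), while the REGISTERED open
stub `stub_vl_carrierRate` of skeleton «cauchy» v3 (d43a8bd19247ce15) is written at the BARE frame `0`.  The transfer between the two is done
here once, at `M = ∞`, where the carrier is the Hamiltonian object `klSelfEnergyInf` (all `U`, k3c5-p3) and the frame enters only through the
explicit inverse dressing `e(n,q) = g_K(n,q)/g₀(n,q)` (`= 1 + K(q)·g_K(n,q)`):

* §1 `‖e‖ ≤ 1 + ‖K‖₀β/π` (`norm_invDress_le`, by `norm_shift_ratio_le`) and **`Σ∞⁰ = e²·Σ∞^K − K·e`** (`klSelfEnergyInf_zero_eq_invDressing`,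
  the inverse of k3c5-p3's `klSelfEnergyInf_eq_dressing`);
* §2 the symbols `e`, `e²`, `K·e` are `2πℤ²`-periodic and sup- and torus-Lipschitz under `FrameOK` (`e(x) − e(y) = e(x)e(y)(d(y) − d(x))` and
  k3c4-p1's modulus `klso_dress_sub_le` of the dressing `d = g₀/g_K`; `norm_sub_le_mul_tmod_of_periodic`);
* §3 **`bareCutoffFreeRate_of_framedCutoffFreeRate`** — a two-volume rate with momentum modulus of `Σ∞^K` and an `L`-uniform bound of `Σ∞^K`
  beyond `L₀` give a two-volume rate of the BARE `Σ∞⁰` beyond `L₀` (rate `(1 + ‖K‖₀β/π)²·ρ`), for every admissible frame and every real `U`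
  — the converse direction of k3c5-p3's `cutoffFreeRate_of_bareRates`.

The finite-cutoff consequence (the registered stub text from the framed export) is `…VolumeLimitFramedToBare`.
Everything is proved; no definition; nothing is asserted about the model.
-/

noncomputable section

namespace Summit.HubbardSuperconductivity.HubbardSuperconductivity.Theorems.TwoPointAssembly

set_option linter.dupNamespace false -- summit = problem name (single-conjunct summit), D-0017

open Filter Topology Finset Literature.MathematicalPhysics.QuantumLattice Literature.Probability.LatticeModels GrassmannAlgebra
open Summit.HubbardSuperconductivity.HubbardSuperconductivity.Theorems.KLProgrammeLegKernels
open Summit.HubbardSuperconductivity.HubbardSuperconductivity.Theorems.KLRegimeSplit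

variable {L : ℕ} [NeZero L]

/-! ## §1 The inverse dressing `e = g_K/g₀` and the bare carrier from the framed one -/

omit [NeZero L] in
/-- The continuum frame propagator never vanishes (`β ≠ 0`). -/
theorem propInt_ne_zero {β : ℝ} (hβ : β ≠ 0) (μ : ℝ) (K : TrigPolyC4v) (n : ℤ) (q : Fin 2 → ℝ) : propInt β μ K n q ≠ 0 :=
  one_div_ne_zero (propInt_den_ne_zero hβ μ K n q)

omit [NeZero L] in
/-- `(g_K/g₀)·(g₀/g_K) = 1`. -/
theorem invDress_mul_dress {β : ℝ} (hβ : β ≠ 0) (μ : ℝ) (K : TrigPolyC4v) (n : ℤ) (q : Fin 2 → ℝ) :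
    propInt β μ K n q / propInt β μ 0 n q * (propInt β μ 0 n q / propInt β μ K n q) = 1 := by
  have h0 := propInt_ne_zero hβ μ 0 n q
  have hK := propInt_ne_zero hβ μ K n q
  field_simp

omit [NeZero L] in
/-- **The inverse dressing is bounded uniformly in the label**: `‖g_K/g₀‖ ≤ 1 + ‖K‖₀·β/π` (`β > 0`). -/
theorem norm_invDress_le {β : ℝ} (hβ : 0 < β) (μ : ℝ) (K : TrigPolyC4v) (n : ℤ) (q : Fin 2 → ℝ) :
    ‖propInt β μ K n q / propInt β μ 0 n q‖ ≤ 1 + K.coeffNorm 0 * (β / Real.pi) := by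
  have hD0 := propInt_den_ne_zero hβ.ne' μ 0 n q
  have hDK := propInt_den_ne_zero hβ.ne' μ K n q
  have hq : propInt β μ K n q / propInt β μ 0 n q =
      (-Complex.I * (freqOfInt β n : ℂ) + (bandCT μ 0 q : ℂ)) / (-Complex.I * (freqOfInt β n : ℂ) + (bandCT μ K q : ℂ)) := by
    rw [propInt, propInt]; field_simp
  have hω : Real.pi / β ≤ |freqOfInt β n| := by
    rw [freqOfInt, abs_div, abs_of_pos hβ, abs_mul, abs_of_pos Real.pi_pos]
    exact div_le_div_of_nonneg_right (le_mul_of_one_le_right Real.pi_pos.le (one_le_abs_two_mul_add_one n)) hβ.le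
  rw [hq]
  refine (norm_shift_ratio_le hβ _ hω _ _).trans ?_
  have hdiff : |bandCT μ 0 q - bandCT μ K q| ≤ K.coeffNorm 0 := by
    have h : bandCT μ 0 q - bandCT μ K q = K.eval q := by simp only [bandCT, TrigPolyC4v.eval_zero]; ring
    rw [h]
    exact TrigPolyC4v.abs_eval_le_coeffNorm K q
  have hβπ : 0 ≤ β / Real.pi := div_nonneg hβ.le Real.pi_pos.le
  linarith [mul_le_mul_of_nonneg_right hdiff hβπ]

/-- **The bare cutoff-free carrier from the framed one**: `Σ∞⁰_L(n,p) = e(n,q)²·Σ∞^K_L(n,p) − K(q)·e(n,q)`, `e = g_K/g₀`, `q = p⃗(p)` (`β ≠ 0`)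
— the inverse of `klSelfEnergyInf_eq_dressing`. -/
theorem klSelfEnergyInf_zero_eq_invDressing {β : ℝ} (hβ : β ≠ 0) (U μ : ℝ) (K : TrigPolyC4v) (n : ℤ) (p : TorusSite 2 L) :
    klSelfEnergyInf L β U μ 0 n p =
      (propInt β μ K n (latticeMomentum L p) / propInt β μ 0 n (latticeMomentum L p)) ^ 2 * klSelfEnergyInf L β U μ K n p -
        (K.eval (latticeMomentum L p) : ℂ) * (propInt β μ K n (latticeMomentum L p) / propInt β μ 0 n (latticeMomentum L p)) := by
  rw [klSelfEnergyInf_eq_dressing hβ U μ K n p, propInt_sub_div_sq_eq hβ]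
  have h0 := propInt_ne_zero hβ μ 0 n (latticeMomentum L p)
  have hK := propInt_ne_zero hβ μ K n (latticeMomentum L p)
  field_simp
  ring

/-! ## §2 The inverse dressing as a momentum symbol: periodic, torus-Lipschitz under `FrameOK` -/

omit [NeZero L] in
/-- Periodicity of the continuum frame propagator (`q + m·2π`). -/
theorem propInt_periodic (β μ : ℝ) (K : TrigPolyC4v) (n : ℤ) (q : Fin 2 → ℝ) (m : Fin 2 → ℤ) :
    propInt β μ K n (fun i => q i + m i * (2 * Real.pi)) = propInt β μ K n q := by
  rw [propInt, propInt, klso_bandCT_periodic']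

section Frame

variable {R : RenConsts} {U₁ : ℝ} {N : ℕ} {μ : ℝ} {K : TrigPolyC4v}

omit [NeZero L] in
/-- **Sup-Lipschitz modulus of the inverse dressing** under `FrameOK`: `‖e(n,x) − e(n,y)‖ ≤ (1 + ‖K‖₀β/π)²·L_d·‖x − y‖_∞` with `L_d` the modulus
of the dressing `d = g₀/g_K` (`klso_dress_sub_le`; `e(x) − e(y) = e(x)e(y)(d(y) − d(x))`). -/
theorem invDress_sub_le {β : ℝ} (hβ : 0 < β) (hK : FrameOK R U₁ N μ K) (n : ℤ) (x y : Fin 2 → ℝ) :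
    ‖propInt β μ K n x / propInt β μ 0 n x - propInt β μ K n y / propInt β μ 0 n y‖ ≤
      (1 + K.coeffNorm 0 * (β / Real.pi)) ^ 2 *
          ((4 + 7 * Real.sqrt 2) * (β / Real.pi) + K.coeffNorm 0 * (4 * β ^ 2 / Real.pi ^ 2)) * ‖x - y‖ := by
  have hx0 := propInt_ne_zero hβ.ne' μ 0 n x
  have hxK := propInt_ne_zero hβ.ne' μ K n x
  have hy0 := propInt_ne_zero hβ.ne' μ 0 n y
  have hyK := propInt_ne_zero hβ.ne' μ K n y
  set ex : ℂ := propInt β μ K n x / propInt β μ 0 n x with hex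
  set ey : ℂ := propInt β μ K n y / propInt β μ 0 n y with hey
  have hsplit : ex - ey = ex * ey * (propInt β μ 0 n y / propInt β μ K n y - propInt β μ 0 n x / propInt β μ K n x) := by
    rw [hex, hey]; field_simp
  have hd : ‖propInt β μ 0 n y / propInt β μ K n y - propInt β μ 0 n x / propInt β μ K n x‖ ≤
      ((4 + 7 * Real.sqrt 2) * (β / Real.pi) + K.coeffNorm 0 * (4 * β ^ 2 / Real.pi ^ 2)) * ‖x - y‖ := by
    rw [propInt_div_eq_dress hβ.ne', propInt_div_eq_dress hβ.ne', norm_sub_rev]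
    exact klso_dress_sub_le hβ hK n x y
  have hexn : ‖ex‖ ≤ 1 + K.coeffNorm 0 * (β / Real.pi) := norm_invDress_le hβ μ K n x
  have heyn : ‖ey‖ ≤ 1 + K.coeffNorm 0 * (β / Real.pi) := norm_invDress_le hβ μ K n y
  have hK0 := TrigPolyC4v.coeffNorm_nonneg 0 K
  rw [hsplit, norm_mul, norm_mul]
  calc ‖ex‖ * ‖ey‖ * ‖propInt β μ 0 n y / propInt β μ K n y - propInt β μ 0 n x / propInt β μ K n x‖
      ≤ (1 + K.coeffNorm 0 * (β / Real.pi)) * (1 + K.coeffNorm 0 * (β / Real.pi)) *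
          (((4 + 7 * Real.sqrt 2) * (β / Real.pi) + K.coeffNorm 0 * (4 * β ^ 2 / Real.pi ^ 2)) * ‖x - y‖) := by
        gcongr
    _ = _ := by ring

omit [NeZero L] in
/-- The squared inverse dressing is sup-Lipschitz: `‖e(x)² − e(y)²‖ ≤ 2(1 + ‖K‖₀β/π)³·L_d·‖x − y‖_∞`. -/
theorem invDressSq_sub_le {β : ℝ} (hβ : 0 < β) (hK : FrameOK R U₁ N μ K) (n : ℤ) (x y : Fin 2 → ℝ) :
    ‖(propInt β μ K n x / propInt β μ 0 n x) ^ 2 - (propInt β μ K n y / propInt β μ 0 n y) ^ 2‖ ≤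
      2 * (1 + K.coeffNorm 0 * (β / Real.pi)) ^ 3 *
          ((4 + 7 * Real.sqrt 2) * (β / Real.pi) + K.coeffNorm 0 * (4 * β ^ 2 / Real.pi ^ 2)) * ‖x - y‖ := by
  set ex : ℂ := propInt β μ K n x / propInt β μ 0 n x with hex
  set ey : ℂ := propInt β μ K n y / propInt β μ 0 n y with hey
  set Bd : ℝ := 1 + K.coeffNorm 0 * (β / Real.pi) with hBd
  set Ld : ℝ := (4 + 7 * Real.sqrt 2) * (β / Real.pi) + K.coeffNorm 0 * (4 * β ^ 2 / Real.pi ^ 2) with hLd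
  have hK0 := TrigPolyC4v.coeffNorm_nonneg 0 K
  have hexn : ‖ex‖ ≤ Bd := norm_invDress_le hβ μ K n x
  have heyn : ‖ey‖ ≤ Bd := norm_invDress_le hβ μ K n y
  have hexy : ‖ex - ey‖ ≤ Bd ^ 2 * Ld * ‖x - y‖ := invDress_sub_le hβ hK n x y
  have hsq : ex ^ 2 - ey ^ 2 = (ex - ey) * (ex + ey) := by ring
  rw [hsq, norm_mul]
  calc ‖ex - ey‖ * ‖ex + ey‖ ≤ (Bd ^ 2 * Ld * ‖x - y‖) * (Bd + Bd) := by
        refine mul_le_mul hexy ((norm_add_le _ _).trans (add_le_add hexn heyn)) (norm_nonneg _) ?_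
        positivity
    _ = _ := by ring

omit [NeZero L] in
/-- The additive bare-frame term `K(q)·e(n,q)` is bounded by `‖K‖₀·(1 + ‖K‖₀β/π)`. -/
theorem norm_eval_mul_invDress_le {β : ℝ} (hβ : 0 < β) (μ : ℝ) (K : TrigPolyC4v) (n : ℤ) (q : Fin 2 → ℝ) :
    ‖(K.eval q : ℂ) * (propInt β μ K n q / propInt β μ 0 n q)‖ ≤ K.coeffNorm 0 * (1 + K.coeffNorm 0 * (β / Real.pi)) := by
  rw [norm_mul, Complex.norm_real, Real.norm_eq_abs]
  exact mul_le_mul (TrigPolyC4v.abs_eval_le_coeffNorm K q) (norm_invDress_le hβ μ K n q) (norm_nonneg _)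
    (TrigPolyC4v.coeffNorm_nonneg 0 K)

omit [NeZero L] in
/-- The additive bare-frame term `K(q)·e(n,q)` is sup-Lipschitz under `FrameOK`. -/
theorem eval_mul_invDress_sub_le {β : ℝ} (hβ : 0 < β) (hK : FrameOK R U₁ N μ K) (n : ℤ) (x y : Fin 2 → ℝ) :
    ‖(K.eval x : ℂ) * (propInt β μ K n x / propInt β μ 0 n x) - (K.eval y : ℂ) * (propInt β μ K n y / propInt β μ 0 n y)‖ ≤
      ((4 + 7 * Real.sqrt 2) * (1 + K.coeffNorm 0 * (β / Real.pi)) +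
          K.coeffNorm 0 * ((1 + K.coeffNorm 0 * (β / Real.pi)) ^ 2 *
            ((4 + 7 * Real.sqrt 2) * (β / Real.pi) + K.coeffNorm 0 * (4 * β ^ 2 / Real.pi ^ 2)))) * ‖x - y‖ := by
  set ex : ℂ := propInt β μ K n x / propInt β μ 0 n x with hex
  set ey : ℂ := propInt β μ K n y / propInt β μ 0 n y with hey
  have hexn : ‖ex‖ ≤ 1 + K.coeffNorm 0 * (β / Real.pi) := norm_invDress_le hβ μ K n x
  have hexy := invDress_sub_le hβ hK n x y
  have hKxy := klso_abs_eval_sub_le hK x y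
  have hKy := TrigPolyC4v.abs_eval_le_coeffNorm K y
  have hK0 := TrigPolyC4v.coeffNorm_nonneg 0 K
  have hsplit : (K.eval x : ℂ) * ex - (K.eval y : ℂ) * ey = ((K.eval x : ℂ) - (K.eval y : ℂ)) * ex + (K.eval y : ℂ) * (ex - ey) := by ring
  rw [hsplit]
  calc ‖((K.eval x : ℂ) - (K.eval y : ℂ)) * ex + (K.eval y : ℂ) * (ex - ey)‖
      ≤ ‖((K.eval x : ℂ) - (K.eval y : ℂ)) * ex‖ + ‖(K.eval y : ℂ) * (ex - ey)‖ := norm_add_le _ _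
    _ = |K.eval x - K.eval y| * ‖ex‖ + |K.eval y| * ‖ex - ey‖ := by
        rw [norm_mul, norm_mul, ← Complex.ofReal_sub, Complex.norm_real, Complex.norm_real, Real.norm_eq_abs, Real.norm_eq_abs]
    _ ≤ (4 + 7 * Real.sqrt 2) * ‖x - y‖ * (1 + K.coeffNorm 0 * (β / Real.pi)) +
          K.coeffNorm 0 * ((1 + K.coeffNorm 0 * (β / Real.pi)) ^ 2 *
            ((4 + 7 * Real.sqrt 2) * (β / Real.pi) + K.coeffNorm 0 * (4 * β ^ 2 / Real.pi ^ 2)) * ‖x - y‖) :=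
        add_le_add (mul_le_mul hKxy hexn (norm_nonneg _) (by positivity)) (mul_le_mul hKy hexy (norm_nonneg _) hK0)
    _ = _ := by ring

omit [NeZero L] in
/-- Torus-Lipschitz form of `invDressSq_sub_le`. -/
theorem invDressSq_sub_le_tmod {β : ℝ} (hβ : 0 < β) (hK : FrameOK R U₁ N μ K) (n : ℤ) (x y : Fin 2 → ℝ) :
    ‖(propInt β μ K n x / propInt β μ 0 n x) ^ 2 - (propInt β μ K n y / propInt β μ 0 n y) ^ 2‖ ≤
      2 * (1 + K.coeffNorm 0 * (β / Real.pi)) ^ 3 *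
          ((4 + 7 * Real.sqrt 2) * (β / Real.pi) + K.coeffNorm 0 * (4 * β ^ 2 / Real.pi ^ 2)) * ∑ i, torusAbs (x i - y i) := by
  have hK0 := TrigPolyC4v.coeffNorm_nonneg 0 K
  refine norm_sub_le_mul_tmod_of_periodic (f := fun q : Fin 2 → ℝ => (propInt β μ K n q / propInt β μ 0 n q) ^ 2)
    (by positivity) (fun p m => ?_) (fun p q => invDressSq_sub_le hβ hK n p q) x y
  simp only [propInt_periodic]

omit [NeZero L] in
/-- Torus-Lipschitz form of `eval_mul_invDress_sub_le`. -/
theorem eval_mul_invDress_sub_le_tmod {β : ℝ} (hβ : 0 < β) (hK : FrameOK R U₁ N μ K) (n : ℤ) (x y : Fin 2 → ℝ) :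
    ‖(K.eval x : ℂ) * (propInt β μ K n x / propInt β μ 0 n x) - (K.eval y : ℂ) * (propInt β μ K n y / propInt β μ 0 n y)‖ ≤
      ((4 + 7 * Real.sqrt 2) * (1 + K.coeffNorm 0 * (β / Real.pi)) +
          K.coeffNorm 0 * ((1 + K.coeffNorm 0 * (β / Real.pi)) ^ 2 *
            ((4 + 7 * Real.sqrt 2) * (β / Real.pi) + K.coeffNorm 0 * (4 * β ^ 2 / Real.pi ^ 2)))) * ∑ i, torusAbs (x i - y i) := by
  have hK0 := TrigPolyC4v.coeffNorm_nonneg 0 K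
  refine norm_sub_le_mul_tmod_of_periodic
    (f := fun q : Fin 2 → ℝ => (K.eval q : ℂ) * (propInt β μ K n q / propInt β μ 0 n q))
    (by positivity) (fun p m => ?_) (fun p q => eval_mul_invDress_sub_le hβ hK n p q) x y
  simp only [propInt_periodic, TrigPolyC4v.eval_periodic]

/-! ## §3 The bare cutoff-free two-volume rate from the framed one -/

/-- **FRAME TRANSFER `K → 0` OF CUTOFF-FREE TWO-VOLUME RATES** (`β > 0`, `FrameOK R U₁ N μ K`, any real `U`).  A two-volume rate with momentum
modulus of the framed cutoff-free carrier, `‖Σ∞^K_L(n,k) − Σ∞^K_{L′}(n,k′)‖ ≤ ρ L + D·Σ_i |p_k i − p′_{k′} i|_𝕋` (`ρ → 0`), and an `L`-uniform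
bound `‖Σ∞^K_L(n,k)‖ ≤ B`, both beyond `L₀`, give a two-volume rate of the BARE cutoff-free carrier `Σ∞⁰` beyond `L₀`
(rate `(1 + ‖K‖₀β/π)²·ρ`; `Σ∞⁰ = e²Σ∞^K − K·e` and §2). -/
theorem bareCutoffFreeRate_of_framedCutoffFreeRate {β : ℝ} (hβ : 0 < β) (hK : FrameOK R U₁ N μ K) (U : ℝ) {L₀ : ℕ} {D B : ℝ}
    {ρ : ℕ → ℝ} (hρ : Tendsto ρ atTop (𝓝 0))
    (hfr : ∀ (L : ℕ) [NeZero L], L₀ ≤ L → ∀ (L' : ℕ) [NeZero L'], L ≤ L' →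
      ∀ (n : ℤ) (k : TorusSite 2 L) (k' : TorusSite 2 L'),
        ‖klSelfEnergyInf L β U μ K n k - klSelfEnergyInf L' β U μ K n k'‖ ≤
          ρ L + D * ∑ i, torusAbs (latticeMomentum L k i - latticeMomentum L' k' i))
    (hB : ∀ (L : ℕ) [NeZero L], L₀ ≤ L → ∀ (n : ℤ) (k : TorusSite 2 L), ‖klSelfEnergyInf L β U μ K n k‖ ≤ B) :
    ∃ D' : ℝ, ∃ ρ' : ℕ → ℝ, Tendsto ρ' atTop (𝓝 0) ∧
      ∀ (L : ℕ) [NeZero L], L₀ ≤ L → ∀ (L' : ℕ) [NeZero L'], L ≤ L' →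
        ∀ (n : ℤ) (k : TorusSite 2 L) (k' : TorusSite 2 L'),
          ‖klSelfEnergyInf L β U μ 0 n k - klSelfEnergyInf L' β U μ 0 n k'‖ ≤
            ρ' L + D' * ∑ i, torusAbs (latticeMomentum L k i - latticeMomentum L' k' i) := by
  have hK0 := TrigPolyC4v.coeffNorm_nonneg 0 K
  -- constants
  set Bd : ℝ := 1 + K.coeffNorm 0 * (β / Real.pi) with hBd
  set Ld : ℝ := (4 + 7 * Real.sqrt 2) * (β / Real.pi) + K.coeffNorm 0 * (4 * β ^ 2 / Real.pi ^ 2) with hLd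
  set L2 : ℝ := 2 * Bd ^ 3 * Ld with hL2
  set Lc : ℝ := (4 + 7 * Real.sqrt 2) * Bd + K.coeffNorm 0 * (Bd ^ 2 * Ld) with hLc
  have hBd0 : 0 ≤ Bd := by positivity
  refine ⟨Bd ^ 2 * D + max B 0 * L2 + Lc, fun L => Bd ^ 2 * ρ L, ?_, ?_⟩
  · simpa using hρ.const_mul (Bd ^ 2)
  intro L _ hL L' _ hLL' n k k'
  have hL' : L₀ ≤ L' := hL.trans hLL'
  set q : Fin 2 → ℝ := latticeMomentum L k with hq
  set q' : Fin 2 → ℝ := latticeMomentum L' k' with hq'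
  set x : ℝ := ∑ i, torusAbs (latticeMomentum L k i - latticeMomentum L' k' i) with hx
  have hx0 : 0 ≤ x := Finset.sum_nonneg fun i _ => klvc_torusAbs_nonneg _
  set eq : ℂ := propInt β μ K n q / propInt β μ 0 n q with heq
  set eq' : ℂ := propInt β μ K n q' / propInt β μ 0 n q' with heq'
  set S : ℂ := klSelfEnergyInf L β U μ K n k with hS
  set S' : ℂ := klSelfEnergyInf L' β U μ K n k' with hS'
  have hE : klSelfEnergyInf L β U μ 0 n k = eq ^ 2 * S - (K.eval q : ℂ) * eq := klSelfEnergyInf_zero_eq_invDressing hβ.ne' U μ K n k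
  have hE' : klSelfEnergyInf L' β U μ 0 n k' = eq' ^ 2 * S' - (K.eval q' : ℂ) * eq' :=
    klSelfEnergyInf_zero_eq_invDressing hβ.ne' U μ K n k'
  -- the four inputs at this pair of volumes
  have h1 : ‖eq ^ 2‖ ≤ Bd ^ 2 := by
    rw [norm_pow]; exact pow_le_pow_left₀ (norm_nonneg _) (norm_invDress_le hβ μ K n q) 2
  have h2 : ‖eq ^ 2 - eq' ^ 2‖ ≤ L2 * x := by
    have h := invDressSq_sub_le_tmod hβ hK n q q'
    have hxx : ∑ i, torusAbs (q i - q' i) = x := by rw [hx]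
    rw [hxx] at h
    simpa only [hL2, hBd, hLd] using h
  have h3 : ‖(K.eval q : ℂ) * eq - (K.eval q' : ℂ) * eq'‖ ≤ Lc * x := by
    have h := eval_mul_invDress_sub_le_tmod hβ hK n q q'
    have hxx : ∑ i, torusAbs (q i - q' i) = x := by rw [hx]
    rw [hxx] at h
    simpa only [hLc, hBd, hLd] using h
  have h4 : ‖S - S'‖ ≤ ρ L + D * x := hfr L hL L' hLL' n k k'
  have h5 : ‖S'‖ ≤ max B 0 := (hB L' hL' n k').trans (le_max_left _ _)
  rw [hE, hE']
  calc ‖eq ^ 2 * S - (K.eval q : ℂ) * eq - (eq' ^ 2 * S' - (K.eval q' : ℂ) * eq')‖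
      = ‖eq ^ 2 * (S - S') + (eq ^ 2 - eq' ^ 2) * S' + -((K.eval q : ℂ) * eq - (K.eval q' : ℂ) * eq')‖ := by congr 1; ring
    _ ≤ ‖eq ^ 2 * (S - S')‖ + ‖(eq ^ 2 - eq' ^ 2) * S'‖ + ‖-((K.eval q : ℂ) * eq - (K.eval q' : ℂ) * eq')‖ := norm_add₃_le
    _ = ‖eq ^ 2‖ * ‖S - S'‖ + ‖eq ^ 2 - eq' ^ 2‖ * ‖S'‖ + ‖(K.eval q : ℂ) * eq - (K.eval q' : ℂ) * eq'‖ := by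
        rw [norm_mul, norm_mul, norm_neg]
    _ ≤ Bd ^ 2 * (ρ L + D * x) + (L2 * x) * max B 0 + Lc * x := by
        have hρ0 : 0 ≤ ρ L + D * x := (norm_nonneg _).trans h4
        gcongr
    _ = Bd ^ 2 * ρ L + (Bd ^ 2 * D + max B 0 * L2 + Lc) * x := by ring

end Frame

end Summit.HubbardSuperconductivity.HubbardSuperconductivity.Theorems.TwoPointAssembly

end
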